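import Literature.Topology.FourManifolds.TautFoliationsPlaques
import HarnessLib

/-!
# Saturated sets of a `C⁰` codimension-one foliation: closures and frontiers are saturated

Sibling of `TautFoliationsPlaques.lean`. A set `S` is **saturated** for the foliation `F`
(`Foliation.IsSaturated`) if it contains the leaf of each of its points (a union of leaves). We
prove the elementary facts used throughout Poincaré–Bendixson-type arguments on saturated open
sets and their frontiers (Camacho–Lins Neto, *Geometric Theory of Foliations*, Ch. III §2: the
saturation of an open set is open, the closure of a saturated set is saturated; Hector–Hirsch,
*Introduction to the Geometry of Foliations, Part A*, Ch. I 2.2):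

* `IsSaturated.closure` (**proved**): **the closure of a saturated set is saturated** — if `a`
  is a limit of points of `S` and `b` lies on the plaque of `a` in a flow box `e`, then `b` is the
  limit of the points of the plaques of those points with the leaf coordinate of `b`, which lie
  in `S`; a chain of plaques propagates this along the leaf.
* `IsSaturated.compl`, `IsSaturated.interior`, `IsSaturated.frontier` (**proved**): complements,
  interiors and frontiers of saturated sets are saturated.
* `isSaturated_leaf`, `IsSaturated.iUnion`, `isSaturated_setOf` (**proved**): leaves, unions of
  saturated sets, and sets defined by a property of the leaf are saturated.

All statements are [folklore].
-/

open scoped Topology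
open Function Set Filter

namespace Literature.Topology.FourManifolds

namespace Foliation

variable {B : Type*} [TopologicalSpace B] {M : Type*} [TopologicalSpace M] (F : Foliation B M)

/-- `S` is **saturated**: it contains the leaf of each of its points. [folklore] -/
def IsSaturated (S : Set M) : Prop := ∀ x ∈ S, F.leaf x ⊆ S

variable {F}

namespace IsSaturated

variable {S : Set M}

/-- A saturated set containing a point of a leaf contains the leaf. [folklore] -/
theorem leaf_subset (hS : F.IsSaturated S) {x : M} (hx : x ∈ S) : F.leaf x ⊆ S := hS x hx

/-- Membership in a saturated set is a property of the leaf. [folklore] -/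
theorem mem_iff_of_mem_leaf (hS : F.IsSaturated S) {x y : M} (hy : y ∈ F.leaf x) : y ∈ S ↔ x ∈ S :=
  ⟨fun h ↦ hS y h (mem_leaf_comm.1 hy), fun h ↦ hS x h hy⟩

/-- **The complement of a saturated set is saturated.** [folklore] -/
theorem compl (hS : F.IsSaturated S) : F.IsSaturated Sᶜ := fun _ hx _ hy hyS ↦
  hx ((hS.mem_iff_of_mem_leaf hy).1 hyS)

/-- **The closure of a saturated set is saturated.** [folklore] -/
theorem closure (hS : F.IsSaturated S) : F.IsSaturated (closure S) := by
  -- one plaque step: along a common plaque, being in the closure propagates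
  have step : ∀ {a b : M}, F.SamePlaque a b → a ∈ _root_.closure S → b ∈ _root_.closure S := by
    intro a b hab ha
    obtain ⟨e, he, hae, hbe, habt⟩ := hab
    rw [mem_closure_iff_nhds]
    intro U hU
    -- the point of the plaque of `w` with the leaf coordinate of `b`
    set g : M → M := fun w ↦ e.symm ((e b).1, (e w).2) with hg
    have hgc : ContinuousAt g a :=
      (F.continuous_symm_of_mem he).continuousAt.comp
        (continuousAt_const.prodMk (continuous_snd.continuousAt.comp (e.continuousAt hae)))
    have hga : g a = b := by
      show e.symm ((e b).1, (e a).2) = b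
      rw [habt, Prod.mk.eta, e.left_inv hbe]
    have hpre : g ⁻¹' U ∈ 𝓝 a := hgc.preimage_mem_nhds (by rw [hga]; exact hU)
    obtain ⟨w, ⟨hwU, hwe⟩, hwS⟩ := mem_closure_iff_nhds.1 ha _ (inter_mem hpre (e.open_source.mem_nhds hae))
    refine ⟨g w, hwU, ?_⟩
    -- `g w` lies on the plaque of `w`, hence in its leaf, hence in `S`
    have hgw : g w ∈ plaque e (e w).2 := F.symm_mem_plaque he _ _
    exact hS w hwS (F.plaque_subset_leaf_of_mem he (F.mem_leaf_self w) (mem_plaque_self hwe) hgw)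
  -- propagate along chains of plaques
  intro x hx y hy
  suffices H : ∀ a b : M, Relation.EqvGen F.SamePlaque a b →
      (a ∈ _root_.closure S ↔ b ∈ _root_.closure S) from (H x y hy).1 hx
  intro a b h
  induction h with
  | rel a b hab => exact ⟨step hab, step hab.symm⟩
  | refl a => exact Iff.rfl
  | symm a b _ ih => exact ih.symm
  | trans a b c _ _ ih₁ ih₂ => exact ih₁.trans ih₂

/-- **The interior of a saturated set is saturated.** [folklore] -/
theorem interior (hS : F.IsSaturated S) : F.IsSaturated (interior S) := by
  rw [interior_eq_compl_closure_compl]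
  exact hS.compl.closure.compl

/-- **The frontier of a saturated set is saturated.** [folklore] -/
theorem frontier (hS : F.IsSaturated S) : F.IsSaturated (frontier S) := fun x hx y hy ↦
  ⟨hS.closure x hx.1 hy, fun hyi ↦ hx.2 (hS.interior y hyi (mem_leaf_comm.1 hy))⟩

/-- A union of saturated sets is saturated. [folklore] -/
theorem iUnion {ι : Sort*} {S : ι → Set M} (hS : ∀ i, F.IsSaturated (S i)) : F.IsSaturated (⋃ i, S i) :=
  fun x hx y hy ↦ by
    obtain ⟨i, hi⟩ := mem_iUnion.1 hx
    exact mem_iUnion.2 ⟨i, hS i x hi hy⟩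

/-- The intersection of two saturated sets is saturated. [folklore] -/
theorem inter {S T : Set M} (hS : F.IsSaturated S) (hT : F.IsSaturated T) : F.IsSaturated (S ∩ T) :=
  fun x hx _ hy ↦ ⟨hS x hx.1 hy, hT x hx.2 hy⟩

end IsSaturated

/-- **Leaves are saturated.** [folklore] -/
theorem isSaturated_leaf (x : M) : F.IsSaturated (F.leaf x) := fun _ hy _ hz ↦ by
  rw [← leaf_eq_of_mem hy]
  exact hz

/-- **A set defined by a property of the leaf is saturated.** [folklore] -/
theorem isSaturated_setOf {P : Set M → Prop} : F.IsSaturated {x | P (F.leaf x)} := fun x hx y hy ↦ by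
  show P (F.leaf y)
  rw [leaf_eq_of_mem hy]
  exact hx

end Foliation

end Literature.Topology.FourManifolds
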